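import Summits.ABC.IUTFork.Conditional.AbcOfSOrNumK
import Summits.ABC.IUTFork.Conditional.AbcExpThreeOfCor312BadDegOne
import HarnessLib

/-!
# DEGREE ONE, K line, «licence OR number» form: polynomial abc (3+ε) for ALL triples / Vojta(1+ε) at the rational points ⇐ ONE hypothesis —
# the (U) number-level Corollary at the admissible RATIONAL SZPIRO-BAD data WHERE OUR TYPED (xi-f) LICENCE FAILS (branch C, abc-iut-C-cert-2 gen 3)

C scoreboard (abc-iut-C-cert-2 gen 3, ODD-revision writer + HYPS.tsv keeper; C-lead ruling C-R38 (2) «DEGREE-ONE RECORD (reading (U))» =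
abc-iut-C-cert-3's `Conditional.abc_exp_three_of_cor312Bad_degOne` p455833, explicit 1 = `h312Bad₁` «`Cor22.Cor312AtDatum P l` at every admissible
RATIONAL Szpiro-bad `(P, l)`»). PROOF-ONLY (no `def`, no new `Prop`, no instance, no notation; nothing re-typed).

THIS FILE is the degree-one twin of the STABLE COMPANION OF RECORD (`abc_of_SH_orNum_K_szpiroBad_hregBad`, p452637): its single hypothesis
`hNumOffBad₁` is abc-iut-C-cert-3's `hNumOffBad` (p451044, VERBATIM) with the guard `P.degree ≤ 1` inserted after `P ∈ UP` — per admissible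
RATIONAL SZPIRO-BAD `(P, l)` and genuine datum `T`: «if OUR typed (xi-f) licence FAILS at the chosen realising ideles / pinned reading of the sharp
setting over `pilotDataOfK T.D T.K`, then `T.Cor312Of`». It is WEAKER than `h312Bad₁` (which demands `T.Cor312Of` at EVERY datum of those points):
where the licence HOLDS, `T.Cor312Of` is abc-iut-C-cert-3's THEOREM `GenuineK.cor312Of_of_SH` (Θ-READ = abc-iut-s2-p6 p447368, q-pin `rfl`,
side conditions `choose_spec`). At `d_mod = 1` the hull regime is a theorem of the tree (abc-iut-S2/S6: `hullVolumeAtDatum_BIII_pinned_of_dmod_eq_one`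
inside `ThetaPartIIDegOne.*`), so NO cone binder occurs: CONE 0 · READ 0 · PIN 0 · SIDE 0.

* `cor312Bad_degOne_of_hNumOffBad₁` — `hNumOffBad₁` ⟹ `h312Bad₁` (per datum `by_cases` on the licence; pure composition);
* **`abc_exp_three_of_orNum_K_degOne`** — `hNumOffBad₁` ⟹ `∀ ε > 0 ∃ C > 0`, `c < C·rad(abc)^{3+ε}` for EVERY abc triple (p455833's tail
  `abc_exp_three_of_cor312Bad_degOne`); explicit 1 = NUM-OFF(rational ∧ Szpiro-bad);
* `vojtaIneq_two_degOne_of_orNum_K` — `hNumOffBad₁` ⟹ Vojta(1+ε) at the rational points of every compactly bounded `K_V ∋ 2` (p455833's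
  `vojtaIneq_two_degOne_of_cor312Bad`).

READING (numbers; no side): by N3 «SZPIRO-SCAN» (abc-iut-rw-num-lead; C-R38 (4)) KNOWN rational data ARE Szpiro-bad at admissible `l`
(e.g. Reyssat's `2 + 3¹⁰·109 = 23⁵` at `l = 13, 17, 19`), so `hNumOffBad₁` bites on a NON-EMPTY known set — exactly the set `{T | ¬ licence(T)}`
over those points, which R-W measures. HONEST FRAMING: locates / conditionally verifies; the conclusion is POLYNOMIAL abc with exponent `3+ε`
(resp. Vojta at degree 1), NOT `_root_.ABC`; nothing here asserts that abc is proved or refuted, or that [IUTchIII] Cor. 3.12 / Thm. 3.11 or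
[IUTchIV] Thm. 1.10 holds or fails at any datum, or takes a side on any author (Mochizuki / Scholze–Stix / Joshi / Dupuy–Hilado); `hNumOffBad₁`
is an assumption label, never asserted; SHARP reading (U); typed ≠ proved; instantiated ≠ endorsed. [claim: Mochizuki2012, status: disputed]
[cite: Mochizuki2012, IUTchIII Cor. 3.12 p. 173–174, Step (xi-f) p. 184; IUTchIV Thm. 1.10 p. 22–23, Cor. 2.2 (ii)–(iii) p. 43–47, Cor. 2.3 p. 54–55]
[cite: MochizukiGenEll2010, Thm. 2.1 p. 12]
-/

noncomputable section

open Set Function NumberField IsDedekindDomain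

namespace Summit.ABC.IUTFork.Conditional

open Thm311 Thm311.Real Cor312 Cor312Vol Cor312Prov Literature.IUT.LogThetaLattice Literature.IUT.LogVolume
  Literature.IUT.HodgeTheaters Literature.IUT.LogVolume.ThetaData
open Literature.NumberTheory.DiophantineGeometry Literature.NumberTheory.DiophantineGeometry.GenEll Summit.ABC.ABC.Theorems

section Family

/-! ## §0. DATA — the stable companion's context binders VERBATIM (p451044 / p452637), as section variables -/

variable
    (M : ∀ (P : NFPoint) (l : ℕ) (T : Cor22.ThetaVolumeDatumAt P l), Type) [∀ P l T, Field (M P l T)] [∀ P l T, NumberField (M P l T)]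
    (archPk : ∀ (P : NFPoint) (l : ℕ) (T : Cor22.ThetaVolumeDatumAt P l), letI := T.instFieldF; letI := T.instNumberFieldF; letI := T.instAlgebraF; letI := T.instFieldK;
        letI := T.instNumberFieldK; letI := T.instAlgebraK; letI := T.instFieldFbar; letI := T.instAlgebraFbar;
        letI := T.instAlgebraKFbar; letI := T.instIsElliptic;
      ∀ (j : (thetaIndex (pilotDataOfK T.D T.K)).Label) (vQ : (thetaIndex (pilotDataOfK T.D T.K)).VQ), Set ((logShellsDH (pilotDataOfK T.D T.K) (analyticLogv T.K)).Packet j vQ))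
    (archSub : ∀ (P : NFPoint) (l : ℕ) (T : Cor22.ThetaVolumeDatumAt P l), letI := T.instFieldF; letI := T.instNumberFieldF; letI := T.instAlgebraF; letI := T.instFieldK;
        letI := T.instNumberFieldK; letI := T.instAlgebraK; letI := T.instFieldFbar; letI := T.instAlgebraFbar;
        letI := T.instAlgebraKFbar; letI := T.instIsElliptic;
      ∀ (j : (thetaIndex (pilotDataOfK T.D T.K)).Label) (v : (thetaIndex (pilotDataOfK T.D T.K)).V), Set ((logShellsDH (pilotDataOfK T.D T.K) (analyticLogv T.K)).Packet j ((thetaIndex (pilotDataOfK T.D T.K)).over v)))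
    (Ψ : ∀ (P : NFPoint) (l : ℕ) (T : Cor22.ThetaVolumeDatumAt P l), letI := T.instFieldF; letI := T.instNumberFieldF; letI := T.instAlgebraF; letI := T.instFieldK;
        letI := T.instNumberFieldK; letI := T.instAlgebraK; letI := T.instFieldFbar; letI := T.instAlgebraFbar;
        letI := T.instAlgebraKFbar; letI := T.instIsElliptic;
      ℤ → ∀ v : (thetaIndex (pilotDataOfK T.D T.K)).V, v ∈ (thetaIndex (pilotDataOfK T.D T.K)).Vbad → Set ((logShellsDH (pilotDataOfK T.D T.K) (analyticLogv T.K)).StarPacket v))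
    (act : ∀ (P : NFPoint) (l : ℕ) (T : Cor22.ThetaVolumeDatumAt P l), letI := T.instFieldF; letI := T.instNumberFieldF; letI := T.instAlgebraF; letI := T.instFieldK;
        letI := T.instNumberFieldK; letI := T.instAlgebraK; letI := T.instFieldFbar; letI := T.instAlgebraFbar;
        letI := T.instAlgebraKFbar; letI := T.instIsElliptic;
      ℤ → ∀ v : (thetaIndex (pilotDataOfK T.D T.K)).V, v ∈ (thetaIndex (pilotDataOfK T.D T.K)).Vbad → (logShellsDH (pilotDataOfK T.D T.K) (analyticLogv T.K)).StarPacket v → Module.End ℚ ((logShellsDH (pilotDataOfK T.D T.K) (analyticLogv T.K)).StarPacket v))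
    (Mmod : ∀ (P : NFPoint) (l : ℕ) (T : Cor22.ThetaVolumeDatumAt P l), letI := T.instFieldF; letI := T.instNumberFieldF; letI := T.instAlgebraF; letI := T.instFieldK;
        letI := T.instNumberFieldK; letI := T.instAlgebraK; letI := T.instFieldFbar; letI := T.instAlgebraFbar;
        letI := T.instAlgebraKFbar; letI := T.instIsElliptic;
      ℤ → ∀ j : (thetaIndex (pilotDataOfK T.D T.K)).LabelStar, Set ((logShellsDH (pilotDataOfK T.D T.K) (analyticLogv T.K)).GlobalPacket j.1))
    (region : ∀ (P : NFPoint) (l : ℕ) (T : Cor22.ThetaVolumeDatumAt P l), letI := T.instFieldF; letI := T.instNumberFieldF; letI := T.instAlgebraF; letI := T.instFieldK;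
        letI := T.instNumberFieldK; letI := T.instAlgebraK; letI := T.instFieldFbar; letI := T.instAlgebraFbar;
        letI := T.instAlgebraKFbar; letI := T.instIsElliptic;
      ℤ → ∀ j : (thetaIndex (pilotDataOfK T.D T.K)).LabelStar, FinDivisor (M P l T) → ∀ vQ : (thetaIndex (pilotDataOfK T.D T.K)).VQ, Set ((logShellsDH (pilotDataOfK T.D T.K) (analyticLogv T.K)).Packet j.1 vQ))
    (frobAdm : ∀ (P : NFPoint) (l : ℕ) (T : Cor22.ThetaVolumeDatumAt P l), letI := T.instFieldF; letI := T.instNumberFieldF; letI := T.instAlgebraF; letI := T.instFieldK;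
        letI := T.instNumberFieldK; letI := T.instAlgebraK; letI := T.instFieldFbar; letI := T.instAlgebraFbar;
        letI := T.instAlgebraKFbar; letI := T.instIsElliptic;
      ℤ → ℤ → ∀ (j : (thetaIndex (pilotDataOfK T.D T.K)).Label) (vQ : (thetaIndex (pilotDataOfK T.D T.K)).VQ), Set ((logShellsDH (pilotDataOfK T.D T.K) (analyticLogv T.K)).Packet j vQ) → Prop)
    (frobLogvol : ∀ (P : NFPoint) (l : ℕ) (T : Cor22.ThetaVolumeDatumAt P l), letI := T.instFieldF; letI := T.instNumberFieldF; letI := T.instAlgebraF; letI := T.instFieldK;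
        letI := T.instNumberFieldK; letI := T.instAlgebraK; letI := T.instFieldFbar; letI := T.instAlgebraFbar;
        letI := T.instAlgebraKFbar; letI := T.instIsElliptic;
      ℤ → ℤ → ∀ (j : (thetaIndex (pilotDataOfK T.D T.K)).Label) (vQ : (thetaIndex (pilotDataOfK T.D T.K)).VQ), Set ((logShellsDH (pilotDataOfK T.D T.K) (analyticLogv T.K)).Packet j vQ) → ℝ)
    (frobΨ : ∀ (P : NFPoint) (l : ℕ) (T : Cor22.ThetaVolumeDatumAt P l), letI := T.instFieldF; letI := T.instNumberFieldF; letI := T.instAlgebraF; letI := T.instFieldK;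
        letI := T.instNumberFieldK; letI := T.instAlgebraK; letI := T.instFieldFbar; letI := T.instAlgebraFbar;
        letI := T.instAlgebraKFbar; letI := T.instIsElliptic;
      ℤ → ℤ → ∀ v : (thetaIndex (pilotDataOfK T.D T.K)).V, v ∈ (thetaIndex (pilotDataOfK T.D T.K)).Vbad → Set ((logShellsDH (pilotDataOfK T.D T.K) (analyticLogv T.K)).StarPacket v))
    (frobMmod : ∀ (P : NFPoint) (l : ℕ) (T : Cor22.ThetaVolumeDatumAt P l), letI := T.instFieldF; letI := T.instNumberFieldF; letI := T.instAlgebraF; letI := T.instFieldK;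
        letI := T.instNumberFieldK; letI := T.instAlgebraK; letI := T.instFieldFbar; letI := T.instAlgebraFbar;
        letI := T.instAlgebraKFbar; letI := T.instIsElliptic;
      ℤ → ℤ → ∀ j : (thetaIndex (pilotDataOfK T.D T.K)).LabelStar, Set ((logShellsDH (pilotDataOfK T.D T.K) (analyticLogv T.K)).GlobalPacket j.1))
    (unitImage : ∀ (P : NFPoint) (l : ℕ) (T : Cor22.ThetaVolumeDatumAt P l), letI := T.instFieldF; letI := T.instNumberFieldF; letI := T.instAlgebraF; letI := T.instFieldK;
        letI := T.instNumberFieldK; letI := T.instAlgebraK; letI := T.instFieldFbar; letI := T.instAlgebraFbar;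
        letI := T.instAlgebraKFbar; letI := T.instIsElliptic;
      ℤ → ℤ → ℕ → ∀ (j : (thetaIndex (pilotDataOfK T.D T.K)).Label) (vQ : (thetaIndex (pilotDataOfK T.D T.K)).VQ), Set ((logShellsDH (pilotDataOfK T.D T.K) (analyticLogv T.K)).Packet j vQ))
    (ballImage : ∀ (P : NFPoint) (l : ℕ) (T : Cor22.ThetaVolumeDatumAt P l), letI := T.instFieldF; letI := T.instNumberFieldF; letI := T.instAlgebraF; letI := T.instFieldK;
        letI := T.instNumberFieldK; letI := T.instAlgebraK; letI := T.instFieldFbar; letI := T.instAlgebraFbar;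
        letI := T.instAlgebraKFbar; letI := T.instIsElliptic;
      ℤ → ℤ → ∀ (j : (thetaIndex (pilotDataOfK T.D T.K)).Label) (vQ : (thetaIndex (pilotDataOfK T.D T.K)).VQ), Set ((logShellsDH (pilotDataOfK T.D T.K) (analyticLogv T.K)).Packet j vQ))
    (thetaDiv : ∀ (P : NFPoint) (l : ℕ) (T : Cor22.ThetaVolumeDatumAt P l), letI := T.instFieldF; letI := T.instNumberFieldF; letI := T.instAlgebraF; letI := T.instFieldK;
        letI := T.instNumberFieldK; letI := T.instAlgebraK; letI := T.instFieldFbar; letI := T.instAlgebraFbar;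
        letI := T.instAlgebraKFbar; letI := T.instIsElliptic;
      ℤ → ℤ → LgpDivisor (M P l T) (thetaIndex (pilotDataOfK T.D T.K)).lstar)
    (n : ∀ (P : NFPoint) (l : ℕ) (T : Cor22.ThetaVolumeDatumAt P l), ℤ)
    {HT : ∀ (P : NFPoint) (l : ℕ) (T : Cor22.ThetaVolumeDatumAt P l), Type} {LogLink : ∀ (P : NFPoint) (l : ℕ) (T : Cor22.ThetaVolumeDatumAt P l), HT P l T → HT P l T → Type}
    {IsFull : ∀ (P : NFPoint) (l : ℕ) (T : Cor22.ThetaVolumeDatumAt P l), ∀ {s t : HT P l T}, LogLink P l T s t → Prop}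
    (lat : ∀ (P : NFPoint) (l : ℕ) (T : Cor22.ThetaVolumeDatumAt P l), LGPGaussianLogThetaLattice (LogLink P l T) (IsFull P l T))
    {Frd : ∀ (P : NFPoint) (l : ℕ) (T : Cor22.ThetaVolumeDatumAt P l), Type} {IsoF : ∀ (P : NFPoint) (l : ℕ) (T : Cor22.ThetaVolumeDatumAt P l), Frd P l T → Frd P l T → Type} {Ob : ∀ (P : NFPoint) (l : ℕ) (T : Cor22.ThetaVolumeDatumAt P l), Frd P l T → Type}
    {realify : ∀ (P : NFPoint) (l : ℕ) (T : Cor22.ThetaVolumeDatumAt P l), Frd P l T → Frd P l T} {Strip : ∀ (P : NFPoint) (l : ℕ) (T : Cor22.ThetaVolumeDatumAt P l), Type} {IsoS : ∀ (P : NFPoint) (l : ℕ) (T : Cor22.ThetaVolumeDatumAt P l), Strip P l T → Strip P l T → Type}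
    {Mv : ∀ (P : NFPoint) (l : ℕ) (T : Cor22.ThetaVolumeDatumAt P l), letI := T.instFieldF; letI := T.instNumberFieldF; letI := T.instAlgebraF; letI := T.instFieldK;
        letI := T.instNumberFieldK; letI := T.instAlgebraK; letI := T.instFieldFbar; letI := T.instAlgebraFbar;
        letI := T.instAlgebraKFbar; letI := T.instIsElliptic;
      ∀ v : (thetaIndex (pilotDataOfK T.D T.K)).V, v ∈ (thetaIndex (pilotDataOfK T.D T.K)).Vbad → Type}
    [∀ P l T v h, Monoid (Mv P l T v h)]
    (sig : ∀ (P : NFPoint) (l : ℕ) (T : Cor22.ThetaVolumeDatumAt P l), letI := T.instFieldF; letI := T.instNumberFieldF; letI := T.instAlgebraF; letI := T.instFieldK;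
        letI := T.instNumberFieldK; letI := T.instAlgebraK; letI := T.instFieldFbar; letI := T.instAlgebraFbar;
        letI := T.instAlgebraKFbar; letI := T.instIsElliptic;
      GlobalLGPFrobenioidSignature (thetaIndex (pilotDataOfK T.D T.K)).lstar (thetaIndex (pilotDataOfK T.D T.K)).V (· ∈ (thetaIndex (pilotDataOfK T.D T.K)).Vbad) (Frd P l T) (IsoF P l T) (Ob P l T) (realify P l T)
        (Strip P l T) (IsoS P l T) (Mv P l T))
    (split : ∀ (P : NFPoint) (l : ℕ) (T : Cor22.ThetaVolumeDatumAt P l), SplittingMonoids (Mv P l T))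
    {ObΔ : ∀ (P : NFPoint) (l : ℕ) (T : Cor22.ThetaVolumeDatumAt P l), Type} {N : ∀ (P : NFPoint) (l : ℕ) (T : Cor22.ThetaVolumeDatumAt P l), letI := T.instFieldF; letI := T.instNumberFieldF; letI := T.instAlgebraF; letI := T.instFieldK;
        letI := T.instNumberFieldK; letI := T.instAlgebraK; letI := T.instFieldFbar; letI := T.instAlgebraFbar;
        letI := T.instAlgebraKFbar; letI := T.instIsElliptic;
      ∀ v : (thetaIndex (pilotDataOfK T.D T.K)).V, v ∈ (thetaIndex (pilotDataOfK T.D T.K)).Vbad → Type}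
    [∀ P l T v h, Monoid (N P l T v h)] (qData : ∀ (P : NFPoint) (l : ℕ) (T : Cor22.ThetaVolumeDatumAt P l), QPilotData (ObΔ P l T) (N P l T))
    (qK : ∀ (P : NFPoint) (l : ℕ) (T : Cor22.ThetaVolumeDatumAt P l), letI := T.instFieldF; letI := T.instNumberFieldF; letI := T.instAlgebraF; letI := T.instFieldK;
        letI := T.instNumberFieldK; letI := T.instAlgebraK; letI := T.instFieldFbar; letI := T.instAlgebraFbar;
        letI := T.instAlgebraKFbar; letI := T.instIsElliptic;
      ∀ v : (thetaIndex (pilotDataOfK T.D T.K)).V, v ∈ (thetaIndex (pilotDataOfK T.D T.K)).Vbad → Set ((logShellsDH (pilotDataOfK T.D T.K) (analyticLogv T.K)).StarPacket v))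

/-- **`hNumOffBad₁ ⟹ h312Bad₁`**: at an admissible RATIONAL SZPIRO-BAD `(P, l)`, `Cor22.Cor312AtDatum P l` — per datum, licence HOLDS ⇒
abc-iut-C-cert-3's `GenuineK.cor312Of_of_SH` (Θ-READ abc-iut-s2-p6 p447368), licence FAILS ⇒ `hNumOffBad₁`. Pure composition; binder text =
p451044's `hNumOffBad` with `P.degree ≤ 1` inserted. [claim: Mochizuki2012, status: disputed] [cite: Mochizuki2012, IUTchIII Cor. 3.12 Step (xi-f) p. 184] -/
theorem cor312Bad_degOne_of_hNumOffBad₁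
    (hNumOffBad₁ : ∀ (P : NFPoint), P ∈ UP → P.degree ≤ 1 → ∀ (l : ℕ), l.Prime → 5 ≤ l →
      Cor22.AdmitsCore P → Cor22.CondP2 P l → Cor22.CondP5 P l → Cor22.CondP6 P l →
      -- ONLY at SZPIRO-BAD `(P, l)` (abc-iut-c312-d1 `Cor22.forall_cor312Of_of_szpiroBad`): off this locus `T.Cor312Of` is a kernel theorem
      (((l : ℝ) + 5) / 4 < (Cor22.dmod P : ℝ) ∨
        6 * l * (((l : ℝ) + 5) - 4 * Cor22.dmod P) / (((l : ℝ) + 4) * ((l : ℝ) - 3))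
            * (P.logDiff + (1 - 1 / (l : ℝ)) * Cor22.logCondAvoid P {2, l})
          + 6 * l * ((l : ℝ) + 5) / (((l : ℝ) + 4) * ((l : ℝ) - 3)) * Real.log Real.pi < Cor22.logQAvoid P {2, l}) →
      ∀ (T : Cor22.ThetaVolumeDatumAt P l), letI := T.instFieldF; letI := T.instNumberFieldF; letI := T.instAlgebraF; letI := T.instFieldK;
        letI := T.instNumberFieldK; letI := T.instAlgebraK; letI := T.instFieldFbar; letI := T.instAlgebraFbar;
        letI := T.instAlgebraKFbar; letI := T.instIsElliptic;
      -- … and ONLY where OUR typed licence FAILS at the chosen ideles / pinned reading: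
      ¬ (Cor312Vol.PilotKummerCompatHull
        (LatticeSituation.ofShells (logShellsDH (pilotDataOfK T.D T.K) (analyticLogv T.K)) (M P l T) (archPk P l T)
          (archSub P l T) (summandPiecesPr (pilotDataOfK T.D T.K) (logvAnalytic_analyticLogv (F := T.K))).Adm
          (summandPiecesPr (pilotDataOfK T.D T.K) (logvAnalytic_analyticLogv (F := T.K))).logvol (Ψ P l T) (act P l T) (Mmod P l T)
          (region P l T) (frobAdm P l T) (frobLogvol P l T) (frobΨ P l T) (frobMmod P l T) (unitImage P l T)
          (ballImage P l T) (thetaDiv P l T))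
        (settingPrVolSharp (pilotDataOfK T.D T.K) (logvAnalytic_analyticLogv (F := T.K)) (M P l T) (archPk P l T) (archSub P l T) (Ψ P l T)
          (act P l T) (Mmod P l T) (region P l T) (n P l T) (lat P l T) (sig P l T) (split P l T) (qData P l T)
          (exists_realising_qIdeles_pilotDataOfK T.D).choose
          (exists_realising_thetaIdeles_pilotDataOfK T.D).choose
          (exists_realising_qIdeles_pilotDataOfK T.D).choose_spec.1
          (exists_realising_qIdeles_pilotDataOfK T.D).choose_spec.2.1)
        (fun _ => Cor312.Setting.qRegion
        (settingPrVolSharp (pilotDataOfK T.D T.K) (logvAnalytic_analyticLogv (F := T.K)) (M P l T) (archPk P l T) (archSub P l T) (Ψ P l T)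
          (act P l T) (Mmod P l T) (region P l T) (n P l T) (lat P l T) (sig P l T) (split P l T) (qData P l T)
          (exists_realising_qIdeles_pilotDataOfK T.D).choose
          (exists_realising_thetaIdeles_pilotDataOfK T.D).choose
          (exists_realising_qIdeles_pilotDataOfK T.D).choose_spec.1
          (exists_realising_qIdeles_pilotDataOfK T.D).choose_spec.2.1)) (qK P l T)) → T.Cor312Of) :
    ∀ P : NFPoint, P ∈ UP → P.degree ≤ 1 → ∀ l : ℕ, l.Prime → 5 ≤ l →
      Cor22.AdmitsCore P → Cor22.CondP2 P l → Cor22.CondP5 P l → Cor22.CondP6 P l →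
      (((l : ℝ) + 5) / 4 < (Cor22.dmod P : ℝ) ∨
        6 * l * (((l : ℝ) + 5) - 4 * Cor22.dmod P) / (((l : ℝ) + 4) * ((l : ℝ) - 3))
            * (P.logDiff + (1 - 1 / (l : ℝ)) * Cor22.logCondAvoid P {2, l})
          + 6 * l * ((l : ℝ) + 5) / (((l : ℝ) + 4) * ((l : ℝ) - 3)) * Real.log Real.pi < Cor22.logQAvoid P {2, l}) →
        Cor22.Cor312AtDatum P l := by
  intro P hP hd1 l hl h5 hc h2 h5' h6 hbad T'
  letI := T'.instFieldF; letI := T'.instNumberFieldF; letI := T'.instAlgebraF; letI := T'.instFieldK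
  letI := T'.instNumberFieldK; letI := T'.instAlgebraK; letI := T'.instFieldFbar; letI := T'.instAlgebraFbar
  letI := T'.instAlgebraKFbar; letI := T'.instIsElliptic
  by_cases hS : (Cor312Vol.PilotKummerCompatHull
        (LatticeSituation.ofShells (logShellsDH (pilotDataOfK T'.D T'.K) (analyticLogv T'.K)) (M P l T') (archPk P l T')
          (archSub P l T') (summandPiecesPr (pilotDataOfK T'.D T'.K) (logvAnalytic_analyticLogv (F := T'.K))).Adm
          (summandPiecesPr (pilotDataOfK T'.D T'.K) (logvAnalytic_analyticLogv (F := T'.K))).logvol (Ψ P l T') (act P l T') (Mmod P l T')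
          (region P l T') (frobAdm P l T') (frobLogvol P l T') (frobΨ P l T') (frobMmod P l T') (unitImage P l T')
          (ballImage P l T') (thetaDiv P l T'))
        (settingPrVolSharp (pilotDataOfK T'.D T'.K) (logvAnalytic_analyticLogv (F := T'.K)) (M P l T') (archPk P l T') (archSub P l T') (Ψ P l T')
          (act P l T') (Mmod P l T') (region P l T') (n P l T') (lat P l T') (sig P l T') (split P l T') (qData P l T')
          (exists_realising_qIdeles_pilotDataOfK T'.D).choose
          (exists_realising_thetaIdeles_pilotDataOfK T'.D).choose
          (exists_realising_qIdeles_pilotDataOfK T'.D).choose_spec.1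
          (exists_realising_qIdeles_pilotDataOfK T'.D).choose_spec.2.1)
        (fun _ => Cor312.Setting.qRegion
        (settingPrVolSharp (pilotDataOfK T'.D T'.K) (logvAnalytic_analyticLogv (F := T'.K)) (M P l T') (archPk P l T') (archSub P l T') (Ψ P l T')
          (act P l T') (Mmod P l T') (region P l T') (n P l T') (lat P l T') (sig P l T') (split P l T') (qData P l T')
          (exists_realising_qIdeles_pilotDataOfK T'.D).choose
          (exists_realising_thetaIdeles_pilotDataOfK T'.D).choose
          (exists_realising_qIdeles_pilotDataOfK T'.D).choose_spec.1
          (exists_realising_qIdeles_pilotDataOfK T'.D).choose_spec.2.1)) (qK P l T'))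
  · exact GenuineK.cor312Of_of_SH T'.D T'.K (M P l T') (archPk P l T') (archSub P l T') (Ψ P l T') (act P l T') (Mmod P l T')
      (region P l T') (frobAdm P l T') (frobLogvol P l T') (frobΨ P l T') (frobMmod P l T') (unitImage P l T') (ballImage P l T')
      (thetaDiv P l T') (n P l T') (lat P l T') (sig P l T') (split P l T') (qData P l T')
      (exists_realising_thetaIdeles_pilotDataOfK T'.D).choose (exists_realising_qIdeles_pilotDataOfK T'.D).choose
      (fun _ => Cor312.Setting.qRegion
          (settingPrVolSharp (pilotDataOfK T'.D T'.K) (logvAnalytic_analyticLogv (F := T'.K)) (M P l T') (archPk P l T') (archSub P l T') (Ψ P l T')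
          (act P l T') (Mmod P l T') (region P l T') (n P l T') (lat P l T') (sig P l T') (split P l T') (qData P l T')
          (exists_realising_qIdeles_pilotDataOfK T'.D).choose
          (exists_realising_thetaIdeles_pilotDataOfK T'.D).choose
          (exists_realising_qIdeles_pilotDataOfK T'.D).choose_spec.1
          (exists_realising_qIdeles_pilotDataOfK T'.D).choose_spec.2.1)) (qK P l T')
      T'.isVolumeInputOf (exists_realising_qIdeles_pilotDataOfK T'.D).choose_spec.1
      (exists_realising_qIdeles_pilotDataOfK T'.D).choose_spec.2.1 (exists_realising_thetaIdeles_pilotDataOfK T'.D).choose_spec.1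
      (exists_realising_thetaIdeles_pilotDataOfK T'.D).choose_spec.2.1 (exists_realising_qIdeles_pilotDataOfK T'.D).choose_spec.2.2
      hS (fun _ _ => rfl)
      (negLogTheta_settingPrVolSharp_pilotDataOfK_le_datum T' (M P l T') (archPk P l T') (archSub P l T') (Ψ P l T') (act P l T')
        (Mmod P l T') (region P l T') (n P l T') (lat P l T') (sig P l T') (split P l T') (qData P l T')
        (exists_realising_qIdeles_pilotDataOfK T'.D).choose (exists_realising_thetaIdeles_pilotDataOfK T'.D).choose
        (exists_realising_qIdeles_pilotDataOfK T'.D).choose_spec.1 (exists_realising_qIdeles_pilotDataOfK T'.D).choose_spec.2.1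
        (exists_realising_thetaIdeles_pilotDataOfK T'.D).choose_spec.1 (exists_realising_thetaIdeles_pilotDataOfK T'.D).choose_spec.2.2)
  · exact hNumOffBad₁ P hP hd1 l hl h5 hc h2 h5' h6 hbad T' hS

/-- **`abc_exp_three_of_orNum_K_degOne`** — polynomial abc with exponent `3+ε` for EVERY abc triple from ONE hypothesis: the (U) number-level
Corollary `T.Cor312Of` at the admissible RATIONAL SZPIRO-BAD data WHERE OUR TYPED (xi-f) LICENCE FAILS (`hNumOffBad₁`). Explicit 1; CONE 0
(`d_mod = 1`: the hull regime is a theorem inside abc-iut-S6's tail), READ 0, PIN 0, SIDE 0. «polynomial abc follows from this hypothesis as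
typed» — no side taken on [IUTchIII] Cor. 3.12 or [IUTchIV] Thm. 1.10; typed ≠ proved; instantiated ≠ endorsed. [claim: Mochizuki2012, status: disputed]
[cite: Mochizuki2012, IUTchIV Cor. 2.2–2.3 pp. 41–55] -/
theorem abc_exp_three_of_orNum_K_degOne
    (hNumOffBad₁ : ∀ (P : NFPoint), P ∈ UP → P.degree ≤ 1 → ∀ (l : ℕ), l.Prime → 5 ≤ l →
      Cor22.AdmitsCore P → Cor22.CondP2 P l → Cor22.CondP5 P l → Cor22.CondP6 P l →
      -- ONLY at SZPIRO-BAD `(P, l)` (abc-iut-c312-d1 `Cor22.forall_cor312Of_of_szpiroBad`): off this locus `T.Cor312Of` is a kernel theorem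
      (((l : ℝ) + 5) / 4 < (Cor22.dmod P : ℝ) ∨
        6 * l * (((l : ℝ) + 5) - 4 * Cor22.dmod P) / (((l : ℝ) + 4) * ((l : ℝ) - 3))
            * (P.logDiff + (1 - 1 / (l : ℝ)) * Cor22.logCondAvoid P {2, l})
          + 6 * l * ((l : ℝ) + 5) / (((l : ℝ) + 4) * ((l : ℝ) - 3)) * Real.log Real.pi < Cor22.logQAvoid P {2, l}) →
      ∀ (T : Cor22.ThetaVolumeDatumAt P l), letI := T.instFieldF; letI := T.instNumberFieldF; letI := T.instAlgebraF; letI := T.instFieldK;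
        letI := T.instNumberFieldK; letI := T.instAlgebraK; letI := T.instFieldFbar; letI := T.instAlgebraFbar;
        letI := T.instAlgebraKFbar; letI := T.instIsElliptic;
      -- … and ONLY where OUR typed licence FAILS at the chosen ideles / pinned reading:
      ¬ (Cor312Vol.PilotKummerCompatHull
        (LatticeSituation.ofShells (logShellsDH (pilotDataOfK T.D T.K) (analyticLogv T.K)) (M P l T) (archPk P l T)
          (archSub P l T) (summandPiecesPr (pilotDataOfK T.D T.K) (logvAnalytic_analyticLogv (F := T.K))).Adm
          (summandPiecesPr (pilotDataOfK T.D T.K) (logvAnalytic_analyticLogv (F := T.K))).logvol (Ψ P l T) (act P l T) (Mmod P l T)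
          (region P l T) (frobAdm P l T) (frobLogvol P l T) (frobΨ P l T) (frobMmod P l T) (unitImage P l T)
          (ballImage P l T) (thetaDiv P l T))
        (settingPrVolSharp (pilotDataOfK T.D T.K) (logvAnalytic_analyticLogv (F := T.K)) (M P l T) (archPk P l T) (archSub P l T) (Ψ P l T)
          (act P l T) (Mmod P l T) (region P l T) (n P l T) (lat P l T) (sig P l T) (split P l T) (qData P l T)
          (exists_realising_qIdeles_pilotDataOfK T.D).choose
          (exists_realising_thetaIdeles_pilotDataOfK T.D).choose
          (exists_realising_qIdeles_pilotDataOfK T.D).choose_spec.1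
          (exists_realising_qIdeles_pilotDataOfK T.D).choose_spec.2.1)
        (fun _ => Cor312.Setting.qRegion
        (settingPrVolSharp (pilotDataOfK T.D T.K) (logvAnalytic_analyticLogv (F := T.K)) (M P l T) (archPk P l T) (archSub P l T) (Ψ P l T)
          (act P l T) (Mmod P l T) (region P l T) (n P l T) (lat P l T) (sig P l T) (split P l T) (qData P l T)
          (exists_realising_qIdeles_pilotDataOfK T.D).choose
          (exists_realising_thetaIdeles_pilotDataOfK T.D).choose
          (exists_realising_qIdeles_pilotDataOfK T.D).choose_spec.1
          (exists_realising_qIdeles_pilotDataOfK T.D).choose_spec.2.1)) (qK P l T)) → T.Cor312Of)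
    {ε : ℝ} (hε : 0 < ε) :
    ∃ C : ℝ, 0 < C ∧ ∀ a b c : ℕ, IsABCTriple a b c → (c : ℝ) < C * ((rad a b c : ℕ) : ℝ) ^ (3 + ε) :=
  abc_exp_three_of_cor312Bad_degOne
    (cor312Bad_degOne_of_hNumOffBad₁ M archPk archSub Ψ act Mmod region frobAdm frobLogvol frobΨ frobMmod unitImage ballImage thetaDiv n
      lat sig split qData qK hNumOffBad₁) hε

/-- **`vojtaIneq_two_degOne_of_orNum_K`** — Vojta(1+ε) at the rational points of every compactly bounded `K_V ∋ 2` from the same ONE hypothesis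
`hNumOffBad₁` (abc-iut-S2's `ThetaPartIIDisplay.vojtaIneq_two_degOne_of_cor312` under the cut). CONDITIONAL; nothing asserted.
[claim: Mochizuki2012, status: disputed] [cite: Mochizuki2012, IUTchIV Cor. 2.2–2.3 pp. 41–55] -/
theorem vojtaIneq_two_degOne_of_orNum_K
    (hNumOffBad₁ : ∀ (P : NFPoint), P ∈ UP → P.degree ≤ 1 → ∀ (l : ℕ), l.Prime → 5 ≤ l →
      Cor22.AdmitsCore P → Cor22.CondP2 P l → Cor22.CondP5 P l → Cor22.CondP6 P l →
      -- ONLY at SZPIRO-BAD `(P, l)` (abc-iut-c312-d1 `Cor22.forall_cor312Of_of_szpiroBad`): off this locus `T.Cor312Of` is a kernel theorem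
      (((l : ℝ) + 5) / 4 < (Cor22.dmod P : ℝ) ∨
        6 * l * (((l : ℝ) + 5) - 4 * Cor22.dmod P) / (((l : ℝ) + 4) * ((l : ℝ) - 3))
            * (P.logDiff + (1 - 1 / (l : ℝ)) * Cor22.logCondAvoid P {2, l})
          + 6 * l * ((l : ℝ) + 5) / (((l : ℝ) + 4) * ((l : ℝ) - 3)) * Real.log Real.pi < Cor22.logQAvoid P {2, l}) →
      ∀ (T : Cor22.ThetaVolumeDatumAt P l), letI := T.instFieldF; letI := T.instNumberFieldF; letI := T.instAlgebraF; letI := T.instFieldK;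
        letI := T.instNumberFieldK; letI := T.instAlgebraK; letI := T.instFieldFbar; letI := T.instAlgebraFbar;
        letI := T.instAlgebraKFbar; letI := T.instIsElliptic;
      -- … and ONLY where OUR typed licence FAILS at the chosen ideles / pinned reading:
      ¬ (Cor312Vol.PilotKummerCompatHull
        (LatticeSituation.ofShells (logShellsDH (pilotDataOfK T.D T.K) (analyticLogv T.K)) (M P l T) (archPk P l T)
          (archSub P l T) (summandPiecesPr (pilotDataOfK T.D T.K) (logvAnalytic_analyticLogv (F := T.K))).Adm
          (summandPiecesPr (pilotDataOfK T.D T.K) (logvAnalytic_analyticLogv (F := T.K))).logvol (Ψ P l T) (act P l T) (Mmod P l T)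
          (region P l T) (frobAdm P l T) (frobLogvol P l T) (frobΨ P l T) (frobMmod P l T) (unitImage P l T)
          (ballImage P l T) (thetaDiv P l T))
        (settingPrVolSharp (pilotDataOfK T.D T.K) (logvAnalytic_analyticLogv (F := T.K)) (M P l T) (archPk P l T) (archSub P l T) (Ψ P l T)
          (act P l T) (Mmod P l T) (region P l T) (n P l T) (lat P l T) (sig P l T) (split P l T) (qData P l T)
          (exists_realising_qIdeles_pilotDataOfK T.D).choose
          (exists_realising_thetaIdeles_pilotDataOfK T.D).choose
          (exists_realising_qIdeles_pilotDataOfK T.D).choose_spec.1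
          (exists_realising_qIdeles_pilotDataOfK T.D).choose_spec.2.1)
        (fun _ => Cor312.Setting.qRegion
        (settingPrVolSharp (pilotDataOfK T.D T.K) (logvAnalytic_analyticLogv (F := T.K)) (M P l T) (archPk P l T) (archSub P l T) (Ψ P l T)
          (act P l T) (Mmod P l T) (region P l T) (n P l T) (lat P l T) (sig P l T) (split P l T) (qData P l T)
          (exists_realising_qIdeles_pilotDataOfK T.D).choose
          (exists_realising_thetaIdeles_pilotDataOfK T.D).choose
          (exists_realising_qIdeles_pilotDataOfK T.D).choose_spec.1
          (exists_realising_qIdeles_pilotDataOfK T.D).choose_spec.2.1)) (qK P l T)) → T.Cor312Of)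
    {ε : ℝ} (hε : 0 < ε) (D : CBData) (hD : D.SupportContains {2}) : VojtaIneq D.toSet 1 ε :=
  vojtaIneq_two_degOne_of_cor312Bad
    (cor312Bad_degOne_of_hNumOffBad₁ M archPk archSub Ψ act Mmod region frobAdm frobLogvol frobΨ frobMmod unitImage ballImage thetaDiv n
      lat sig split qData qK hNumOffBad₁) hε D hD

end Family

end Summit.ABC.IUTFork.Conditional

end
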